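import Literature.AlgebraicGeometry.HodgeTheory.RealSl2BlocksTimesCMPartialFFT
import Literature.AlgebraicGeometry.HodgeTheory.Sl2IsotypicWordLemmas
import Literature.AlgebraicGeometry.HodgeTheory.WeilClassesHodgeType
import Literature.AlgebraicGeometry.Milne1999.LefschetzGroup
import Literature.AlgebraicGeometry.Pohlmann1968.HodgeClassesCMType
import HarnessLib

/-!
# Tensor invariants killed by `𝔰𝔩₂` placed at the `A`-positions only, ISOTYPIC case: the relative first fundamental theorem
# `(M ⊗ N)^{𝔰𝔩₂ ⊗ 1} = M^{𝔰𝔩₂} ⊗ N` evaluated in cohomology — divisor classes cup typed monomials (Lombardo 2016 Lemma 3.4 /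
# Moonen–Zarhin 1999 (3.1); Murty 1984 / Gordon §7.3.2; Goodman–Wallach §4.1.1)

Family `hodge`, layer `Literature/AlgebraicGeometry/HodgeTheory`.  Written for the cell `pub-hodgecm2` (COR-CM), seat `b27`,
count-neutral lane MT-RANK-FIVE-HODGE (sequel of `Sl2IsotypicTimesCMInvariance`).  UNCONDITIONAL; theorems only, no definition,
no named fact (D-0026); no use of HC_CM and no step towards a summit statement.  It is the `𝔰𝔩₂`-ISOTYPIC twin of the tree's
`wordEval_mem_span_divisor_cup_monomial` (`RealSl2BlocksTimesCMPartialFFT`, cell `pub-hodge-ring2`, COLOURWISE `𝔰𝔩₂`'s at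
the `A`-places), whose splitting/gluing machinery (`exists_leftSplit`, `sum_glueTensor_single_smul`,
`cupPowOne_sumElim_eq_sign_smul_cupProduct`, the tree's `BlockwiseSl2Invariants`) it reuses BY NAME; the first fundamental
theorem on the block is the DIAGONAL one of the lane MT-RANK-FOUR-DIVISORS (`mem_span_polytabloid_rect_of_wordRaise_eq_zero`,
`sum_polytabloid_smul_mem_of_cross`, file `Sl2IsotypicWordLemmas`).

THE STEP FORMALISED HERE.  Let the letters of an abelian variety `X` be two-sorted: `A`-letters `f₁^*(y_A((j, τ), r))`,
indexed by `((j, inl τ), r)`, pull-backs along `f₁ : X → B` of degree-one classes `y_A` of `B` whose CROSSED CLASSES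
`y_A(i,0) ⌣ y_A(i',1) + y_A(i',0) ⌣ y_A(i,1)` are `ℂ`-combinations of rational `(1,1)`-classes of `B` (the pair-basis letters of
an abelian variety with slots over a non-CM `A` of Hodge-group rank three, `sl2Cross_mem_span_rational_oneOne`), and `C`-letters
`f₂^*(y_C((j, i), r))`, indexed by `((j, inr i), r)`, pull-backs along `f₂ : X → Z` of degree-one classes of `Z` of Hodge type
`(1,0)` (`r = 0`) resp. `(0,1)` (`r = 1`).  MAIN THEOREM `wordEval_mem_span_divisor_cup_typed_of_isotypic`: if a coefficient
function `a` is killed, slice by slice along slot-and-place words, by the raising operator `E₀₁` and by `h = diag(1,-1)` placed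
SIMULTANEOUSLY at all `A`-positions (`0` at the `C`-positions) — the output of `AVSlots.exists_coeff_killed_at_isotypic_places_of_prod_cmType`
— then `∑_w a(w) · x_w` lies in the `ℂ`-span of the classes `f₁^* d ⌣ f₂^* μ` with `d` in the span of the RATIONAL `(l,l)`-classes of
`B` (indeed `d ∈ D^{l}(B) ⊗ ℂ`) and `μ` a monomial in the `C`-letters, of PURE Hodge type — exactly the hypothesis shape of the tree's
criterion `mem_span_hodgeProductClasses_of_mem_span_typed` (`HodgeClassesProductSpanCriterion`).
PROOF (Goodman–Wallach §4.1.1 «`(M ⊗ N)^{𝔤 ⊗ 1} = M^{𝔤} ⊗ N`»).  Slot-and-place word by slot-and-place word: split the positions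
into `A`-positions and `C`-positions (`exists_leftSplit`); the isotypic family is the constant block family (`isotypicFamily_eq_blockFamilyAt`),
so every block slice is killed by `E₀₁` and `h` placed at ALL block positions (`wordDerAt_blockFamilyAt_eq_zero_iff`); glue
(`eq_sum_glueTensor_blockSlice`, `sum_glueTensor_single_smul`) and evaluate (`cupPowOne_sumElim_eq_sign_smul_cupProduct`): the block part
evaluates into `D^{p'}(B) ⊗ ℂ` by the first fundamental theorem for the diagonal `SL₂` (`sum_smul_cupPowOneAlt_mem_divisorClassesSpan_of_wordDer`,
below), an odd block carries only the zero tensor (`eq_zero_of_wordDer_diag_eq_zero_of_odd`), and the complement monomial has the pure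
type counted by its kinds (`isOfHodgeType_cupPowOne`).

## References
* [Lombardo2016] D. Lombardo, Ann. Inst. Fourier 66 (2016), Lemma 3.4 (p. 1229). [cite: Lombardo2016, Lemma 3.4 (p. 1229)]
* [MoonenZarhin1999LowDim] B. Moonen, Yu. Zarhin, Math. Ann. 315 (1999), §2, §3 (3.1). [cite: MoonenZarhin1999LowDim, §3 (3.1)]
* [Gordon1997] B. B. Gordon, App. B of Lewis (1999) = arXiv:alg-geom/9709030, §3, §7.3.2, Thm. 7.5. [cite: Gordon1997, §7.3.2 and Thm. 7.5]
* [GoodmanWallachGTM255] R. Goodman, N. R. Wallach, GTM 255, §4.1.1 and Thm. 5.3.3. [cite: GoodmanWallachGTM255, §4.1.1]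
* [HatcherAT2002] A. Hatcher, *Algebraic Topology* (2002), §3.2 Prop. 3.10. [cite: HatcherAT2002, §3.2 Prop. 3.10]
* [VoisinHodgeI2002] C. Voisin, *Hodge Theory I*, §7.1.2, Thm. 11.38. [cite: VoisinHodgeI2002, §7.1.2 and Thm. 5.29]
-/

noncomputable section

open scoped TensorProduct
open CategoryTheory Module

namespace Literature.AlgebraicGeometry.HodgeTheory

open Literature.AlgebraicTopology.SingularHomology
open Literature.AlgebraicGeometry.Motives (IsSmoothProjective AbelianVariety bettiCohomology
  ofRatClassBaseChange)
open Literature.Barriers.HodgeConjecture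
open Literature.RepresentationTheory.GeneralLinear
open Literature.NumberTheory.DiophantineGeometry

/-! ### §1 Word model: the isotypic two-sorted family is a constant block family -/

section Words

variable {K : Type*} [CommRing K] {J T P : Type*} {d m r : ℕ} (φ : Fin d ≃ Fin m ⊕ Fin r)

/-- **The isotypic operator of the `A`-places is a constant block family** for the split
`φ : positions ≃ A-positions ⊕ C-positions` of a slot-and-place word `U`: `Y` at every `A`-position and `0` at every
`C`-position is `(Y at all block positions) ⊕ 0` (`blockFamilyAt` of the constant family). [cite: GoodmanWallachGTM255, §4.1.1] -/
theorem isotypicFamily_eq_blockFamilyAt (U : Fin d → J × (T ⊕ P)) (τA : Fin m → T) (iC : Fin r → P)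
    (hA : ∀ a, (U (φ.symm (Sum.inl a))).2 = Sum.inl (τA a)) (hC : ∀ b, (U (φ.symm (Sum.inr b))).2 = Sum.inr (iC b))
    (Y : Matrix (Fin 2) (Fin 2) K) :
    (fun t => Sum.elim (fun _ : T => Y) (fun _ : P => (0 : Matrix (Fin 2) (Fin 2) K)) (U t).2) =
      blockFamilyAt K φ (fun _ => Y) := by
  funext q
  obtain ⟨w, rfl⟩ := φ.symm.surjective q
  rcases w with a | b
  · rw [blockFamilyAt_inl, hA]; rfl
  · rw [blockFamilyAt_inr, hC]; rfl

/-- **Transfer of the kill to the block slices**: if `Y` placed at all `A`-positions kills the slice `s`, then `Y` placed at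
all positions of the block kills every block slice of `s`. [cite: GoodmanWallachGTM255, §4.1.1] -/
theorem wordDer_blockSlice_eq_zero_of_isotypic [Fintype T] [DecidableEq T] [DecidableEq P] (U : Fin d → J × (T ⊕ P))
    (τA : Fin m → T) (iC : Fin r → P) (hA : ∀ a, (U (φ.symm (Sum.inl a))).2 = Sum.inl (τA a))
    (hC : ∀ b, (U (φ.symm (Sum.inr b))).2 = Sum.inr (iC b)) (Y : Matrix (Fin 2) (Fin 2) K) {s : Word 2 d → K}
    (h : wordDerAt K (fun t => Sum.elim (fun _ : T => Y) (fun _ : P => (0 : Matrix (Fin 2) (Fin 2) K)) (U t).2) s = 0)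
    (η : Word 2 r) : wordDer K Y (blockSlice φ s η) = 0 := by
  rw [isotypicFamily_eq_blockFamilyAt φ U τA iC hA hC Y] at h
  rw [← wordDerAt_const]
  exact (wordDerAt_blockFamilyAt_eq_zero_iff K φ _ s).1 h η

/-- The two cardinalities of a left/right split add up to the number of positions. [folklore] -/
private theorem card_isLeft_add_card_not_isLeft' (col : Fin d → T ⊕ P) :
    Fintype.card {t // (col t).isLeft = true} + Fintype.card {t // ¬ (col t).isLeft = true} = d := by
  classical
  rw [Fintype.card_subtype_compl, Nat.add_sub_cancel' (Fintype.card_subtype_le _), Fintype.card_fin]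

end Words

/-! ### §2 Evaluation: diagonally-killed block slices on the `A`-letters give divisor classes; typed monomials; the main theorem -/

section Evaluation

variable {B Z X : AbelianVariety ℂ} {n : ℕ}

/-- **(Per slot word) the evaluation of a tensor killed by `E₀₁` and `h` placed at ALL positions, on letters with divisorial
crossed classes, lies in `Dᵖ'(B) ⊗ ℂ`** — the per-slice form of the tree's `wordEval_mem_divisorClassesSpan_of_wordRaise_eq_zero_of_cross`
(first fundamental theorem for the diagonal `SL₂`: `h`-killed means colour-balanced (`wordContent_eq_of_wordDer_diag_eq_zero`),
`E₀₁`-killed balanced tensors are combinations of rectangular polytabloids (`mem_span_polytabloid_rect_of_wordRaise_eq_zero`), whose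
evaluations are products of crossed classes (`sum_polytabloid_smul_mem_of_cross`)). [cite: Gordon1997, §3 and §7.3.2]
[cite: GoodmanWallachGTM255, Thm. 5.3.3] -/
theorem sum_smul_cupPowOneAlt_mem_divisorClassesSpan_of_wordDer {ι : Type*} [Fintype ι] [DecidableEq ι]
    (y : ι × Fin 2 → complexBetti B.X 1)
    (hcross : ∀ i j, cupProduct (rfl : 1 + 1 = 2) (y (i, 0)) (y (j, 1)) +
        cupProduct (rfl : 1 + 1 = 2) (y (j, 0)) (y (i, 1)) ∈
      Submodule.span ℂ {b : complexBetti B.X 2 | IsRationalClass b ∧ IsOfHodgeType B.dim B.X 2 1 1 b})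
    {p' : ℕ} (u : Fin (2 * p') → ι) (s : Word 2 (2 * p') → ℂ)
    (hE : wordDer ℂ (Matrix.single 0 1 (1 : ℂ)) s = 0) (hH : wordDer ℂ (Matrix.diagonal ![(1 : ℂ), -1]) s = 0) :
    ∑ ε : Word 2 (2 * p'), s ε •
        cupPowOneAlt ℂ (Motives.ComplexPoints B.X) (2 * p') (fun t => y (u t, ε t)) ∈
      divisorClassesSpan B.X B.dim p' := by
  classical
  have hraise : wordRaise ℂ 0 1 s = 0 := by rw [← wordDer_single]; exact hE
  have hbal : ∀ w, s w ≠ 0 → ∀ i : Fin 2, wordContent w i = p' := by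
    intro w hw i
    have h01 := wordContent_eq_of_wordDer_diag_eq_zero ℂ hH w hw
    have hsum := sum_wordContent w
    rw [Fin.sum_univ_two] at hsum
    fin_cases i
    · change wordContent w 0 = p'; omega
    · change wordContent w 1 = p'; omega
  have hslice := mem_span_polytabloid_rect_of_wordRaise_eq_zero ℂ p' hraise hbal
  set L : (Word 2 (2 * p') → ℂ) →ₗ[ℂ] complexBetti B.X (2 * p') :=
    Fintype.linearCombination ℂ (fun ε : Word 2 (2 * p') =>
      cupPowOneAlt ℂ (Motives.ComplexPoints B.X) (2 * p') (fun t => y (u t, ε t))) with hL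
  have hLapply : ∀ c' : Word 2 (2 * p') → ℂ, L c' = ∑ ε, c' ε •
      cupPowOneAlt ℂ (Motives.ComplexPoints B.X) (2 * p') (fun t => y (u t, ε t)) :=
    fun c' => Fintype.linearCombination_apply ℂ _ c'
  rw [← hLapply]
  have hle : Submodule.span ℂ
      (Set.range fun T : StdFilling (2 * p') (twoRowRect p') => T.polytabloid ℂ (twoRowRect_fst_lt p')) ≤
      (divisorClassesSpan B.X B.dim p').comap L := by
    refine Submodule.span_le.2 ?_
    rintro _ ⟨T, rfl⟩
    change L (T.polytabloid ℂ _) ∈ divisorClassesSpan B.X B.dim p'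
    rw [hLapply]
    exact sum_polytabloid_smul_mem_of_cross y hcross T u
  exact hle hslice

/-- **A monomial in Hodge-adapted degree-one classes has the pure type counted by its kinds**: if `y(l, 0)` is of type `(1,0)`
and `y(l, 1)` of type `(0,1)`, the iterated cup product along a word `w` with kinds `η` is of type
`(#{t | η t = 0}, #{t | η t = 1})` (types add under cup products, `isOfHodgeType_cupPowOne`; in degree `0` the only type is `(0,0)`).
[cite: VoisinHodgeI2002, §7.1.2 and Thm. 5.29] -/
theorem exists_isOfHodgeType_cupPowOne_of_kinds {L : Type*} (y : L × Fin 2 → complexBetti Z.X 1)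
    (hy0 : ∀ l, IsOfHodgeType Z.dim Z.X 1 1 0 (y (l, 0))) (hy1 : ∀ l, IsOfHodgeType Z.dim Z.X 1 0 1 (y (l, 1)))
    {r : ℕ} (w : Fin r → L) (η : Word 2 r) :
    ∃ r₀ r₁, r₀ + r₁ = r ∧ IsOfHodgeType Z.dim Z.X r r₀ r₁
      (cupPowOne ℂ (Motives.ComplexPoints Z.X) r (fun t => y (w t, η t))) := by
  have hZ : IsSmoothProjective Z.dim Z.X := AbelianVariety.isSmoothProjective_holds
  rcases Nat.eq_zero_or_pos r with hr | hr
  · subst hr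
    exact ⟨0, 0, rfl, Literature.AlgebraicGeometry.Pohlmann1968.isOfHodgeType_of_degree_zero hZ _⟩
  · refine ⟨∑ t, (if η t = 0 then 1 else 0), ∑ t, (if η t = 0 then 0 else 1), ?_,
      isOfHodgeType_cupPowOne hZ hr _ (fun t => if η t = 0 then 1 else 0) (fun t => if η t = 0 then 0 else 1)
        fun t => ?_⟩
    · rw [← Finset.sum_add_distrib]
      have h1 : ∀ t : Fin r, ((if η t = 0 then 1 else 0) + (if η t = 0 then 0 else 1) : ℕ) = 1 := fun t => by
        split_ifs <;> rfl
      simp only [h1, Finset.sum_const, Finset.card_univ, Fintype.card_fin, smul_eq_mul, mul_one]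
    · rcases Fin.eq_zero_or_eq_succ (η t) with h0 | ⟨j, hj⟩
      · rw [h0]; simpa using hy0 (w t)
      · have h1 : η t = 1 := by rw [hj, Fin.eq_zero j]; rfl
        rw [h1]; simpa using hy1 (w t)

open scoped Classical in
/-- **MAIN THEOREM (evaluation of tensors killed by `𝔰𝔩₂ ⊕ 0` acting isotypically at the `A`-positions).**  Let the letters of
`X` be the `A`-letters `f₁^*(y_A((j, τ), r))`, `((j, inl τ), r)`, with divisorial crossed classes on `B`, and the `C`-letters
`f₂^*(y_C((j, i), r))`, `((j, inr i), r)`, pull-backs of degree-one classes of `Z` of type `(1,0)` (`r = 0`) / `(0,1)` (`r = 1`).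
If a coefficient function `a` on words of length `2p` is killed, slice by slice along slot-and-place words, by `E₀₁` and by
`diag(1,-1)` placed at ALL `A`-positions (`0` at the `C`-positions), then `∑_w a(w) · x_w` is a `ℂ`-combination of classes
`f₁^* d ⌣ f₂^* μ` with `d` in the span of the rational `(l,l)`-classes of `B` and `μ` of pure type on `Z` — the invariants of
`SL₂ × (anything)` are (divisor classes) ⊗ (everything): Goodman–Wallach «`(M ⊗ N)^{𝔤 ⊗ 1} = M^{𝔤} ⊗ N`» with the first fundamental
theorem for the diagonal `SL₂` on the first factor (Murty; Gordon §7.3.2). [cite: Lombardo2016, Lemma 3.4 (p. 1229)]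
[cite: MoonenZarhin1999LowDim, §3 (3.1)] [cite: GoodmanWallachGTM255, §4.1.1] [cite: Gordon1997, §7.3.2 and Thm. 7.5] -/
theorem wordEval_mem_span_divisor_cup_typed_of_isotypic (f₁ : X ⟶ B) (f₂ : X ⟶ Z)
    {T : Type*} [Fintype T] [DecidableEq T] (yA : (Fin n × T) × Fin 2 → complexBetti B.X 1)
    (hcross : ∀ i j, cupProduct (rfl : 1 + 1 = 2) (yA (i, 0)) (yA (j, 1)) +
        cupProduct (rfl : 1 + 1 = 2) (yA (j, 0)) (yA (i, 1)) ∈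
      Submodule.span ℂ {b : complexBetti B.X 2 | IsRationalClass b ∧ IsOfHodgeType B.dim B.X 2 1 1 b})
    {P : Type*} [Fintype P] [DecidableEq P] (yC : (Fin n × P) × Fin 2 → complexBetti Z.X 1)
    (hyC0 : ∀ l, IsOfHodgeType Z.dim Z.X 1 1 0 (yC (l, 0))) (hyC1 : ∀ l, IsOfHodgeType Z.dim Z.X 1 0 1 (yC (l, 1)))
    {p : ℕ} {a : (Fin (2 * p) → (Fin n × (T ⊕ P)) × Fin 2) → ℂ}
    (hEa : ∀ U : Fin (2 * p) → Fin n × (T ⊕ P),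
      wordDerAt ℂ (fun t => Sum.elim (fun _ : T => Matrix.single 0 1 (1 : ℂ)) (fun _ : P => (0 : Matrix (Fin 2) (Fin 2) ℂ))
        (U t).2) (wordSlice a U) = 0)
    (hHa : ∀ U : Fin (2 * p) → Fin n × (T ⊕ P),
      wordDerAt ℂ (fun t => Sum.elim (fun _ : T => Matrix.diagonal ![(1 : ℂ), -1])
        (fun _ : P => (0 : Matrix (Fin 2) (Fin 2) ℂ)) (U t).2) (wordSlice a U) = 0) :
    wordEval (cupPowOneAlt ℂ (Motives.ComplexPoints X.X) (2 * p))
      (fun jr : (Fin n × (T ⊕ P)) × Fin 2 => Sum.elim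
        (fun τ => complexBetti.map f₁.hom.hom.hom 1 (yA ((jr.1.1, τ), jr.2)))
        (fun i => complexBetti.map f₂.hom.hom.hom 1 (yC ((jr.1.1, i), jr.2))) jr.1.2) a ∈
      Submodule.span ℂ {z : complexBetti X.X (2 * p) | ∃ (i j : ℕ) (hij : i + j = 2 * p)
        (d : complexBetti B.X i) (μ : complexBetti Z.X j),
        d ∈ Submodule.span ℂ {d' : complexBetti B.X i | IsRationalClass d' ∧
          ∃ l, 2 * l = i ∧ IsOfHodgeType B.dim B.X i l l d'} ∧
        (∃ r₀ r₁, r₀ + r₁ = j ∧ IsOfHodgeType Z.dim Z.X j r₀ r₁ μ) ∧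
        z = cupProduct hij (complexBetti.map f₁.hom.hom.hom i d) (complexBetti.map f₂.hom.hom.hom j μ)} := by
  classical
  have hB : IsSmoothProjective B.dim B.X := AbelianVariety.isSmoothProjective_holds
  rw [wordEval_eq_sum_wordSlice]
  refine Submodule.sum_mem _ fun U _ => ?_
  -- the two-sorted colouring of the positions and its left/right split
  set col : Fin (2 * p) → T ⊕ P := fun t => (U t).2 with hcol
  set s : Word 2 (2 * p) → ℂ := wordSlice a U with hs
  set m := Fintype.card {t // (col t).isLeft = true} with hm
  set r := Fintype.card {t // ¬ (col t).isLeft = true} with hr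
  have hmr : m + r = 2 * p := card_isLeft_add_card_not_isLeft' col
  -- the letters along a glued word
  have hword : ∀ {m' : ℕ} (φ : Fin (2 * p) ≃ Fin m' ⊕ Fin r) (τA : Fin m' → T) (iC : Fin r → P),
      (∀ a', col (φ.symm (Sum.inl a')) = Sum.inl (τA a')) → (∀ b', col (φ.symm (Sum.inr b')) = Sum.inr (iC b')) →
      ∀ (ε₁ : Word 2 m') (η : Word 2 r),
      (fun t => (fun jr : (Fin n × (T ⊕ P)) × Fin 2 => Sum.elim
          (fun τ => complexBetti.map f₁.hom.hom.hom 1 (yA ((jr.1.1, τ), jr.2)))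
          (fun i => complexBetti.map f₂.hom.hom.hom 1 (yC ((jr.1.1, i), jr.2))) jr.1.2) (U t, glueWord φ ε₁ η t)) =
        fun t => Sum.elim
          (fun a' => complexBetti.map f₁.hom.hom.hom 1 (yA (((U (φ.symm (Sum.inl a'))).1, τA a'), ε₁ a')))
          (fun b' => complexBetti.map f₂.hom.hom.hom 1 (yC (((U (φ.symm (Sum.inr b'))).1, iC b'), η b')))
          (φ t) := by
    intro m' φ τA iC hA hC ε₁ η
    funext t
    obtain ⟨w, rfl⟩ := φ.symm.surjective t
    rcases w with a' | b'
    · rw [Equiv.apply_symm_apply, Sum.elim_inl, glueWord_apply_inl]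
      have h1 : (U (φ.symm (Sum.inl a'))).2 = Sum.inl (τA a') := hA a'
      simp only [h1, Sum.elim_inl]
    · rw [Equiv.apply_symm_apply, Sum.elim_inr, glueWord_apply_inr]
      have h1 : (U (φ.symm (Sum.inr b'))).2 = Sum.inr (iC b') := hC b'
      simp only [h1, Sum.elim_inr]
  rcases Nat.even_or_odd m with ⟨p', hp'⟩ | hodd
  · -- EVEN block: `m = 2p'`
    have hcardA : Fintype.card {t // (col t).isLeft = true} = 2 * p' := by rw [← hm, hp', two_mul]
    obtain ⟨φ, τA, iC, hA, hC⟩ := exists_leftSplit col hcardA hr.symm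
    have hmr' : 2 * p' + r = 2 * p := by omega
    -- block slices are killed by `E₀₁` and `h` placed at all block positions
    have hEs : ∀ η : Word 2 r, wordDer ℂ (Matrix.single 0 1 (1 : ℂ)) (blockSlice φ s η) = 0 :=
      wordDer_blockSlice_eq_zero_of_isotypic φ U τA iC hA hC _ (hEa U)
    have hHs : ∀ η : Word 2 r, wordDer ℂ (Matrix.diagonal ![(1 : ℂ), -1]) (blockSlice φ s η) = 0 :=
      wordDer_blockSlice_eq_zero_of_isotypic φ U τA iC hA hC _ (hHa U)
    -- decompose the slice along the split and evaluate
    rw [eq_sum_glueTensor_blockSlice φ s]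
    simp only [Finset.sum_apply, Finset.sum_smul]
    rw [Finset.sum_comm]
    refine Submodule.sum_mem _ fun η _ => ?_
    rw [sum_glueTensor_single_smul φ (blockSlice φ s η) η]
    -- the slot-and-place words of the two parts
    set uA : Fin (2 * p') → Fin n × T := fun a' => ((U (φ.symm (Sum.inl a'))).1, τA a') with huA
    set uC : Fin r → Fin n × P := fun b' => ((U (φ.symm (Sum.inr b'))).1, iC b') with huC
    set sgn : ℂ := (((Equiv.Perm.sign (φ.trans (finSumFinEquiv.trans (finCongr hmr'))) : ℤˣ) : ℤ) : ℂ)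
      with hsgn
    set dB : complexBetti B.X (2 * p') := ∑ ε₁ : Word 2 (2 * p'), blockSlice φ s η ε₁ •
      cupPowOneAlt ℂ (Motives.ComplexPoints B.X) (2 * p') (fun t => yA (uA t, ε₁ t)) with hdB
    have hdBmem : dB ∈ divisorClassesSpan B.X B.dim p' :=
      sum_smul_cupPowOneAlt_mem_divisorClassesSpan_of_wordDer yA hcross uA (blockSlice φ s η) (hEs η) (hHs η)
    have hdBtyped : dB ∈ Submodule.span ℂ {d' : complexBetti B.X (2 * p') | IsRationalClass d' ∧
        ∃ l, 2 * l = 2 * p' ∧ IsOfHodgeType B.dim B.X (2 * p') l l d'} := by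
      refine Submodule.span_mono (fun d' hd' => ?_) (Milne1999.divisorClassesSpan_le_span_hodgeClasses hB p' hdBmem)
      exact ⟨hd'.1, p', rfl, hd'.2⟩
    set μ : complexBetti Z.X r := cupPowOne ℂ (Motives.ComplexPoints Z.X) r (fun t => yC (uC t, η t)) with hμ
    have hμtyped : ∃ r₀ r₁, r₀ + r₁ = r ∧ IsOfHodgeType Z.dim Z.X r r₀ r₁ μ :=
      exists_isOfHodgeType_cupPowOne_of_kinds yC hyC0 hyC1 uC η
    have hterm : ∀ ε₁ : Word 2 (2 * p'),
        cupPowOneAlt ℂ (Motives.ComplexPoints X.X) (2 * p) (fun t =>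
          (fun jr : (Fin n × (T ⊕ P)) × Fin 2 => Sum.elim
            (fun τ => complexBetti.map f₁.hom.hom.hom 1 (yA ((jr.1.1, τ), jr.2)))
            (fun i => complexBetti.map f₂.hom.hom.hom 1 (yC ((jr.1.1, i), jr.2))) jr.1.2) (U t, glueWord φ ε₁ η t)) =
        sgn • cupProduct hmr'
          (complexBetti.map f₁.hom.hom.hom (2 * p')
            (cupPowOneAlt ℂ (Motives.ComplexPoints B.X) (2 * p') (fun t => yA (uA t, ε₁ t))))
          (complexBetti.map f₂.hom.hom.hom r μ) := by
      intro ε₁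
      rw [hword φ τA iC hA hC ε₁ η, cupPowOneAlt_apply, cupPowOne_sumElim_eq_sign_smul_cupProduct ℂ φ hmr',
        cupPowOneAlt_apply, hμ, Motives.complexBetti_map_cupPowOne, Motives.complexBetti_map_cupPowOne]
    simp only [hterm]
    have hsum : ∑ ε₁ : Word 2 (2 * p'), blockSlice φ s η ε₁ • sgn • cupProduct hmr'
        (complexBetti.map f₁.hom.hom.hom (2 * p')
          (cupPowOneAlt ℂ (Motives.ComplexPoints B.X) (2 * p') (fun t => yA (uA t, ε₁ t))))
        (complexBetti.map f₂.hom.hom.hom r μ) =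
        sgn • cupProduct hmr' (complexBetti.map f₁.hom.hom.hom (2 * p') dB) (complexBetti.map f₂.hom.hom.hom r μ) := by
      rw [hdB, map_sum, LinearMap.map_sum₂, Finset.smul_sum]
      refine Finset.sum_congr rfl fun ε₁ _ => ?_
      rw [map_smul, LinearMap.map_smul₂, smul_comm]
    rw [hsum]
    exact Submodule.smul_mem _ _ (Submodule.subset_span ⟨2 * p', r, hmr', dB, μ, hdBtyped, hμtyped, rfl⟩)
  · -- ODD block: the slice vanishes
    obtain ⟨φ, τA, iC, hA, hC⟩ := exists_leftSplit col hm.symm hr.symm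
    have hHs : ∀ η : Word 2 r, wordDer ℂ (Matrix.diagonal ![(1 : ℂ), -1]) (blockSlice φ s η) = 0 :=
      wordDer_blockSlice_eq_zero_of_isotypic φ U τA iC hA hC _ (hHa U)
    have hzero : ∀ η : Word 2 r, blockSlice φ s η = 0 :=
      fun η => eq_zero_of_wordDer_diag_eq_zero_of_odd ℂ hodd (hHs η)
    have hs0 : ∀ ε, s ε = 0 := fun ε => by
      have h := congrFun (hzero (restWord φ ε)) (blockWord φ ε)
      rwa [blockSlice_apply, glueWord_blockWord_restWord, Pi.zero_apply] at h
    rw [Finset.sum_eq_zero fun ε _ => by rw [hs0 ε, zero_smul]]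
    exact Submodule.zero_mem _

end Evaluation

end Literature.AlgebraicGeometry.HodgeTheory

end
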